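import Literature.Topology.PlanarFoliations.LeafArcs
import Literature.Topology.FourManifolds.OneManifoldArcCharts
import HarnessLib

/-!
# A leaf containing a simple closed curve is compact

Topic: Topology / PlanarFoliations. One-dimensional invariance of domain along the leaves: for a
foliation `F : Foliation ℝ X` with one-dimensional leaves, a **simple closed curve in a leaf**
(a `1`-periodic map `γ : ℝ → F.Leaf x`, continuous in the leaf topology and injective on a
period) **covers the whole leaf, which is therefore compact**:

* `isOpen_range_of_loop` (**proved**): the trace of `γ` is open in the leaf — read in a leaf arc
  through `γ θ₀`, the map `γ` is an injective continuous real function near `θ₀`, hence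
  strictly monotone, so by the intermediate value theorem its image contains an interval
  around the reading of `γ θ₀`;
* `range_loop_eq_univ`, `compactSpace_leaf_of_loop`, `isCompact_leaf_of_loop` (**proved**):
  the trace is also compact, so it is the whole (connected) leaf, which is compact, in the leaf
  topology and as a subset of `X`.

All statements are [folklore] (used for the lifted loops of fences/suspension collars: the
leaves through them are compact).
-/

noncomputable section

open Set Filter Function
open _root_.Topology
open Literature.Topology.FourManifolds Literature.Topology.FourManifolds.Foliation
  Literature.Topology.FourManifolds.OneManifold

namespace Literature.Topology.PlanarFoliations

variable {X : Type*} [TopologicalSpace X] {F : Foliation ℝ X} {x : X}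

/-- A `1`-periodic map injective on `[0, 1)` is injective on every open interval of length `1`.
[folklore] -/
theorem injOn_Ioo_of_periodic {α : Type*} {γ : ℝ → α} (hp : Periodic γ 1) (hinj : InjOn γ (Ico 0 1)) (a : ℝ) :
    InjOn γ (Ioo a (a + 1)) := by
  intro s hs t ht hst
  -- reduce modulo `1`
  have key : ∀ r : ℝ, γ (Int.fract r) = γ r := fun r ↦ by
    rw [show Int.fract r = r - (⌊r⌋ : ℤ) * (1 : ℝ) by rw [mul_one]; rfl]
    exact hp.sub_int_mul_eq ⌊r⌋
  rw [← key s, ← key t] at hst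
  have hs' : Int.fract s ∈ Ico (0 : ℝ) 1 := ⟨Int.fract_nonneg s, Int.fract_lt_one s⟩
  have ht' : Int.fract t ∈ Ico (0 : ℝ) 1 := ⟨Int.fract_nonneg t, Int.fract_lt_one t⟩
  have hfr : Int.fract s = Int.fract t := hinj hs' ht' hst
  -- `s - t` is an integer of absolute value `< 1`
  rw [Int.fract_eq_fract] at hfr
  obtain ⟨k, hk⟩ := hfr
  have hlt : |s - t| < 1 := by rw [abs_lt]; constructor <;> linarith [hs.1, hs.2, ht.1, ht.2]
  rw [hk] at hlt
  have hk0 : k = 0 := by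
    have : |(k : ℝ)| < 1 := hlt
    rw [← Int.cast_abs] at this
    have h' : |k| < 1 := by exact_mod_cast this
    exact Int.abs_lt_one_iff.1 h'
  have : s - t = 0 := by rw [hk, hk0]; simp
  linarith

/-- **The trace of a simple closed curve in a leaf is open in the leaf.** [folklore] -/
theorem isOpen_range_of_loop {γ : ℝ → F.Leaf x} (hγ : Continuous γ) (hp : Periodic γ 1) (hinj : InjOn γ (Ico 0 1)) :
    IsOpen (range γ) := by
  rw [isOpen_iff_mem_nhds]
  rintro _ ⟨θ₀, rfl⟩
  -- a leaf arc through `γ θ₀`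
  obtain ⟨e, he, t, h, hmem⟩ := exists_mem_leafArc_source (γ θ₀)
  set c := leafArc e t h he with hc
  have hct : c.target = univ := leafArc_target h he
  -- `γ` maps a small interval around `θ₀` into the source of `c`
  have hpre : γ ⁻¹' c.source ∈ 𝓝 θ₀ := hγ.continuousAt.preimage_mem_nhds ((isOpen_leafArc_source h he).mem_nhds hmem)
  obtain ⟨ε, hε, hball⟩ := Metric.mem_nhds_iff.1 hpre
  set δ := min (ε / 2) (1 / 4 : ℝ) with hδ
  have hδpos : 0 < δ := lt_min (by linarith) (by norm_num)
  have hδε : δ ≤ ε / 2 := min_le_left _ _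
  have hδ4 : δ ≤ 1 / 4 := min_le_right _ _
  have hIcc : Icc (θ₀ - δ) (θ₀ + δ) ⊆ γ ⁻¹' c.source := fun s hs ↦ hball (by
    rw [Metric.mem_ball, Real.dist_eq, abs_lt]; constructor <;> linarith [hs.1, hs.2])
  -- the reading `g = c ∘ γ` is continuous and injective on the interval, hence strictly monotone
  set g : ℝ → ℝ := fun s ↦ c (γ s) with hg
  have hgc : ContinuousOn g (Icc (θ₀ - δ) (θ₀ + δ)) :=
    c.continuousOn.comp hγ.continuousOn fun s hs ↦ hIcc hs
  have hginj : InjOn g (Icc (θ₀ - δ) (θ₀ + δ)) := by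
    intro s hs s' hs' hss'
    have h1 : γ s = γ s' := c.injOn (hIcc hs) (hIcc hs') hss'
    exact injOn_Ioo_of_periodic hp hinj (θ₀ - 1 / 2) ⟨by linarith [hs.1], by linarith [hs.2]⟩
      ⟨by linarith [hs'.1], by linarith [hs'.2]⟩ h1
  have hmono := strictMonoOn_or_strictAntiOn_of_continuousOn ordConnected_Icc hgc hginj
  -- in both cases the image of the open interval contains an open interval around `g θ₀`
  have hθ₀ : θ₀ ∈ Icc (θ₀ - δ) (θ₀ + δ) := ⟨by linarith, by linarith⟩
  have ha : θ₀ - δ ∈ Icc (θ₀ - δ) (θ₀ + δ) := ⟨le_rfl, by linarith⟩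
  have hb : θ₀ + δ ∈ Icc (θ₀ - δ) (θ₀ + δ) := ⟨by linarith, le_rfl⟩
  obtain ⟨lo, hi, hlo, hhi, hsub⟩ : ∃ lo hi, lo < g θ₀ ∧ g θ₀ < hi ∧ Ioo lo hi ⊆ g '' Ioo (θ₀ - δ) (θ₀ + δ) := by
    rcases hmono with hm | hm
    · refine ⟨g (θ₀ - δ), g (θ₀ + δ), hm ha hθ₀ (by linarith), hm hθ₀ hb (by linarith), ?_⟩
      exact intermediate_value_Ioo (by linarith) hgc
    · refine ⟨g (θ₀ + δ), g (θ₀ - δ), hm hθ₀ hb (by linarith), hm ha hθ₀ (by linarith), ?_⟩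
      have := intermediate_value_Ioo' (by linarith : θ₀ - δ ≤ θ₀ + δ) hgc
      exact this
  -- pull back: points of the leaf read in `(lo, hi)` near `γ θ₀` are on the trace
  have hnhds : c.source ∩ c ⁻¹' Ioo lo hi ∈ 𝓝 (γ θ₀) := by
    refine inter_mem ((isOpen_leafArc_source h he).mem_nhds hmem) ?_
    exact (c.continuousAt hmem).preimage_mem_nhds (isOpen_Ioo.mem_nhds ⟨hlo, hhi⟩)
  refine mem_of_superset hnhds ?_
  rintro q ⟨hqs, hq⟩
  obtain ⟨s, hs, hgs⟩ := hsub hq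
  refine ⟨s, c.injOn (hIcc ⟨hs.1.le, hs.2.le⟩) hqs ?_⟩
  exact hgs

/-- **A simple closed curve in a leaf covers the leaf.** [folklore] -/
theorem range_loop_eq_univ [T2Space X] {γ : ℝ → F.Leaf x} (hγ : Continuous γ) (hp : Periodic γ 1)
    (hinj : InjOn γ (Ico 0 1)) : range γ = univ := by
  have hcpt : IsCompact (range γ) := by
    have : range γ = γ '' Icc 0 1 := by
      apply Subset.antisymm
      · rintro _ ⟨s, rfl⟩
        refine ⟨Int.fract s, ⟨Int.fract_nonneg s, (Int.fract_lt_one s).le⟩, ?_⟩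
        rw [show Int.fract s = s - (⌊s⌋ : ℤ) * (1 : ℝ) by rw [mul_one]; rfl]
        exact hp.sub_int_mul_eq ⌊s⌋
      · rintro _ ⟨s, -, rfl⟩; exact ⟨s, rfl⟩
    rw [this]
    exact isCompact_Icc.image hγ
  have hclopen : IsClopen (range γ) := ⟨hcpt.isClosed, isOpen_range_of_loop hγ hp hinj⟩
  exact hclopen.eq_univ ⟨γ 0, 0, rfl⟩

/-- **A leaf containing a simple closed curve is compact** (in its leaf topology). [folklore] -/
theorem compactSpace_leaf_of_loop [T2Space X] {γ : ℝ → F.Leaf x} (hγ : Continuous γ) (hp : Periodic γ 1)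
    (hinj : InjOn γ (Ico 0 1)) : CompactSpace (F.Leaf x) := by
  refine ⟨?_⟩
  rw [← range_loop_eq_univ hγ hp hinj]
  have : range γ = γ '' Icc 0 1 := by
    apply Subset.antisymm
    · rintro _ ⟨s, rfl⟩
      refine ⟨Int.fract s, ⟨Int.fract_nonneg s, (Int.fract_lt_one s).le⟩, ?_⟩
      rw [show Int.fract s = s - (⌊s⌋ : ℤ) * (1 : ℝ) by rw [mul_one]; rfl]
      exact hp.sub_int_mul_eq ⌊s⌋
    · rintro _ ⟨s, -, rfl⟩; exact ⟨s, rfl⟩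
  rw [this]
  exact isCompact_Icc.image hγ

/-- **A leaf containing a simple closed curve is a compact subset of `X`**, equal to the trace of
the curve. [folklore] -/
theorem isCompact_leaf_of_loop [T2Space X] {γ : ℝ → F.Leaf x} (hγ : Continuous γ) (hp : Periodic γ 1)
    (hinj : InjOn γ (Ico 0 1)) : IsCompact (F.leaf x) := by
  have hcs := compactSpace_leaf_of_loop hγ hp hinj
  have : F.leaf x = (fun q : F.Leaf x ↦ ofLeafSpace (q : F.LeafSpace)) '' univ := by
    apply Subset.antisymm
    · intro y hy; exact ⟨Leaf.mk y hy, mem_univ _, rfl⟩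
    · rintro _ ⟨q, -, rfl⟩; exact q.2
  rw [this]
  exact isCompact_univ.image (Leaf.continuous_coe F x)

end Literature.Topology.PlanarFoliations
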